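import Literature.NumberTheory.LFunctions.RudnickSarnakProofs
import Mathlib.Analysis.SpecialFunctions.Integrals.Basic
import Mathlib.MeasureTheory.Integral.Pi
import Mathlib.LinearAlgebra.Matrix.Determinant.Basic
import HarnessLib

/-!
# Rudnick–Sarnak §4 for `ζ`: the GUE side of Theorem 4.1 as cube integrals

Z. Rudnick, P. Sarnak, Duke Math. J. **81** (1996), proof of Proposition 4.2 (pp. 309–311): the
GUE functional `∫ f_Φ(x) W_n(x) δ(x̄) dx` (`rsLimit`, with `f_Φ = rsPhiTest Φ` the test function
(3.6) attached to `Φ`) is computed by expanding the determinant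
`W_n(x) = ∑_σ sign σ ∏_i K(x_i - x_{σ(i)})` ((4.27)) and taking the Fourier transform of each
summand, using that `K = Ω̂` is the Fourier transform of the indicator `Ω` of `[-1/2, 1/2]`
((4.21)). Here the `n = k + 1` variables `s ∈ [-1/2, 1/2]ⁿ` of the representation
`∏_i K(x_{σ i} - x_i) = ∫_{[-1/2,1/2]ⁿ} e(∑_i (x_{σ i} - x_i) s_i) ds` are kept together (RS go on to
integrate cycle by cycle, Lemma 4.2, which is the next file), and Fourier inversion on the
hyperplane gives the **cube form**

* `rsLimit_rsPhiTest_eq_sum_cubeFunctional` :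
  `rsLimit k f_Φ = ∑_{σ ∈ S_n} sign σ ∫_{[-1/2,1/2]ⁿ} Φ(s ∘ σ - s) ds`

for admissible `Φ` (`IsRSAdmissiblePhi`) with Schwartz slice. Everything is proved.

## Contents

* `rsCube n = [-1/2, 1/2]ⁿ`, `cubeFunctional σ Φ = ∫_{rsCube} Φ(s ∘ σ - s) ds`.
* `sineKernel_eq_integral` (`K(x) = ∫_{-1/2}^{1/2} e(xt) dt`, i.e. `K = Ω̂`, RS (4.21)),
  `prod_sineKernel_eq_integral`, `sineDeterminant_eq_sum` ((4.27)).
* `integral_slice_mul_cexp_eq` (Fourier inversion on the hyperplane),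
  `integral_slice_mul_prod_sineKernel` (one permutation), and the theorem.

## References

* Z. Rudnick, P. Sarnak, Duke Math. J. 81 (1996), (1.5), (3.6), (4.21), (4.27), Lemma 4.2.
-/

noncomputable section

open Complex MeasureTheory Finset Equiv
open scoped Real FourierTransform

namespace Literature.NumberTheory.LFunctions

namespace RudnickSarnak

/-! ## The cube and the cube functional -/

/-- The cube `[-1/2, 1/2]ⁿ ⊆ ℝⁿ` (the support of `Ω ⊗ ⋯ ⊗ Ω`, `Ω = 𝟙_{[-1/2,1/2]}`, RS (4.21)).
[cite: RudnickSarnak1996, (4.21)] -/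
def rsCube (n : ℕ) : Set (Fin n → ℝ) := Set.pi Set.univ fun _ ↦ Set.Icc (-1 / 2 : ℝ) (1 / 2)

/-- The cube functional of a permutation `σ`: `I_σ(Φ) = ∫_{[-1/2,1/2]ⁿ} Φ(s ∘ σ - s) ds`, the
paired Fourier transform of the summand `sign σ ∏_i K(x_i - x_{σ i})` of `W_n` ((4.27)) before
the cycle-by-cycle integration of RS Lemma 4.2. [cite: RudnickSarnak1996, (4.27)] -/
def cubeFunctional {n : ℕ} (σ : Perm (Fin n)) (Φ : (Fin n → ℝ) → ℂ) : ℂ :=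
  ∫ s in rsCube n, Φ (fun j ↦ s (σ j) - s j)

/-- The cube is measurable. [folklore] -/
theorem measurableSet_rsCube (n : ℕ) : MeasurableSet (rsCube n) :=
  MeasurableSet.univ_pi fun _ ↦ measurableSet_Icc

/-- The cube has volume `1`. [folklore] -/
theorem volume_rsCube (n : ℕ) : volume (rsCube n) = 1 := by
  have h : ENNReal.ofReal ((1 / 2 : ℝ) - (-1 / 2)) = 1 := by norm_num
  rw [rsCube, volume_pi_pi]
  simp only [Real.volume_Icc, h, Finset.prod_const_one]

/-- Lebesgue measure restricted to the cube is finite. [folklore] -/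
instance (n : ℕ) : IsFiniteMeasure (volume.restrict (rsCube n)) :=
  isFiniteMeasure_restrict.2 (by rw [volume_rsCube]; exact ENNReal.one_ne_top)

/-! ## `K = Ω̂` and the determinant expansion -/

/-- **`K(x) = sin πx / πx = ∫_{-1/2}^{1/2} e(xt) dt`** (`K = Ω̂`, RS (4.21)).
[cite: RudnickSarnak1996, (4.21)] -/
theorem sineKernel_eq_integral (x : ℝ) :
    (sineKernel x : ℂ) = ∫ t in Set.Icc (-1 / 2 : ℝ) (1 / 2), Complex.exp (2 * π * I * (x * t : ℝ)) := by
  rw [integral_Icc_eq_integral_Ioc, ← intervalIntegral.integral_of_le (by norm_num)]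
  by_cases hx : x = 0
  · subst hx
    simp [sineKernel]
    norm_num
  · have hc : (2 * π * x : ℝ) ≠ 0 := by positivity
    have hx' : (x : ℂ) ≠ 0 := Complex.ofReal_ne_zero.2 hx
    have hf : (fun t : ℝ ↦ Complex.exp (2 * π * I * ((x * t : ℝ) : ℂ))) =
        fun t : ℝ ↦ (fun u : ℝ ↦ Complex.exp (u * I)) (2 * π * x * t) := by
      funext t
      congr 1
      push_cast
      ring
    rw [hf, intervalIntegral.integral_comp_mul_left (fun u : ℝ ↦ Complex.exp (u * I)) hc]
    have h1 : 2 * π * x * (-1 / 2) = -(π * x) := by ring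
    have h2 : 2 * π * x * (1 / 2) = π * x := by ring
    rw [h1, h2, integral_exp_mul_I_eq_sinc, sineKernel]
    rw [Complex.real_smul]
    push_cast
    field_simp

/-- `∏_i K(a_i) = ∫_{[-1/2,1/2]ⁿ} e(∑_i a_i s_i) ds`. [cite: RudnickSarnak1996, (4.27)] -/
theorem prod_sineKernel_eq_integral {n : ℕ} (a : Fin n → ℝ) :
    (∏ i, (sineKernel (a i) : ℂ)) =
      ∫ s in rsCube n, Complex.exp (2 * π * I * ∑ i, (a i * s i : ℝ)) := by
  have hexp : ∀ s : Fin n → ℝ, Complex.exp (2 * π * I * ∑ i, (a i * s i : ℝ)) =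
      ∏ i, Complex.exp (2 * π * I * (a i * s i : ℝ)) := by
    intro s
    rw [← Complex.exp_sum]
    congr 1
    push_cast
    rw [Finset.mul_sum]
  simp_rw [hexp]
  rw [rsCube, volume_pi, Measure.restrict_pi_pi,
    integral_fintype_prod_eq_prod (𝕜 := ℂ) (fun i (t : ℝ) ↦ Complex.exp (2 * π * I * (a i * t : ℝ)))]
  refine Finset.prod_congr rfl fun i _ ↦ ?_
  rw [sineKernel_eq_integral]

/-- The determinant expansion `W_n(x) = ∑_σ sign σ ∏_i K(x_{σ i} - x_i)` ((4.27); `K` is even),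
cast to `ℂ`. [cite: RudnickSarnak1996, (4.27)] -/
theorem sineDeterminant_eq_sum {n : ℕ} (x : Fin n → ℝ) :
    (sineDeterminant x : ℂ) =
      ∑ σ : Perm (Fin n), ((Equiv.Perm.sign σ : ℤ) : ℂ) * ∏ i, (sineKernel (x (σ i) - x i) : ℂ) := by
  unfold sineDeterminant
  rw [Matrix.det_apply']
  push_cast
  rfl

/-- `|∏_i K(a_i)| ≤ 1`. [folklore] -/
theorem norm_prod_sineKernel_le {n : ℕ} (a : Fin n → ℝ) : ‖∏ i, (sineKernel (a i) : ℂ)‖ ≤ 1 := by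
  rw [norm_prod]
  refine Finset.prod_le_one (fun i _ ↦ norm_nonneg _) fun i _ ↦ ?_
  rw [Complex.norm_real, Real.norm_eq_abs]
  exact Real.abs_sinc_le_one _

/-! ## Fourier inversion on the hyperplane -/

/-- Transport of `𝓕⁻` on `EuclideanSpace ℝ (Fin k)` to the explicit integral on `Fin k → ℝ`:
`𝓕⁻ (F ∘ ofLp) (toLp w) = ∫ F(y) e^{2πi y·w} dy`. [folklore] -/
theorem fourierInv_euclidean_toLp {k : ℕ} (F : (Fin k → ℝ) → ℂ) (w : Fin k → ℝ) :
    𝓕⁻ (fun v : EuclideanSpace ℝ (Fin k) ↦ F (WithLp.ofLp v)) (WithLp.toLp 2 w) =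
      ∫ y : Fin k → ℝ, F y * Complex.exp (2 * π * I * ∑ i, (y i * w i : ℝ)) := by
  rw [Real.fourierInv_eq_fourier_neg, show -(WithLp.toLp 2 w : EuclideanSpace ℝ (Fin k)) =
    WithLp.toLp 2 (-w) by rfl, fourier_euclidean_toLp]
  congr 1
  funext y
  congr 1
  simp only [Pi.neg_apply, mul_neg, Finset.sum_neg_distrib, Complex.ofReal_neg, neg_neg]

/-- The hyperplane slice `Φ̃(η) = Φ(-∑η, η)` of an admissible `Φ` is continuous. [folklore] -/
theorem continuous_phiSlice {k : ℕ} {Φ : (Fin (k + 1) → ℝ) → ℂ} (hΦ : IsRSAdmissiblePhi k Φ) :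
    Continuous fun η : Fin k → ℝ ↦ Φ (Fin.cons (-∑ i, η i) η) := by
  refine hΦ.contDiff.continuous.comp ?_
  refine continuous_pi fun j ↦ ?_
  refine Fin.cases ?_ (fun i ↦ ?_) j
  · simp only [Fin.cons_zero]
    exact (continuous_finsetSum _ fun i _ ↦ continuous_apply i).neg
  · simp only [Fin.cons_succ]
    exact continuous_apply i

/-- The hyperplane slice of an admissible `Φ` has compact support. [folklore] -/
theorem hasCompactSupport_phiSlice {k : ℕ} {Φ : (Fin (k + 1) → ℝ) → ℂ}
    (hΦ : IsRSAdmissiblePhi k Φ) :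
    HasCompactSupport fun η : Fin k → ℝ ↦ Φ (Fin.cons (-∑ i, η i) η) := by
  refine HasCompactSupport.of_support_subset_isCompact (isCompact_closedBall (0 : Fin k → ℝ) 2)
    fun η hη ↦ ?_
  rw [Metric.mem_closedBall, dist_zero_right]
  by_contra hlt
  refine hη (hΦ.eq_zero_of_le_norm ?_)
  refine (not_le.1 hlt).le.trans ?_
  rw [pi_norm_le_iff_of_nonneg (norm_nonneg _)]
  intro i
  have := norm_le_pi_norm (Fin.cons (-∑ i, η i) η : Fin (k + 1) → ℝ) i.succ
  simpa using this

/-- **Fourier inversion on the hyperplane.** For admissible `Φ` with Schwartz slice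
`F = f_Φ(0, ·)` (`F(y) = ∫ Φ̃(η) e^{-2πi y·η} dη`, `Φ̃(η) = Φ(-∑η, η)`):
`∫ F(y) e^{2πi y·w} dy = Φ̃(w)`. [cite: RudnickSarnak1996, (3.6)] -/
theorem integral_slice_mul_cexp_eq {k : ℕ} {Φ : (Fin (k + 1) → ℝ) → ℂ} (hΦ : IsRSAdmissiblePhi k Φ)
    (hslice : ∃ g : SchwartzMap (Fin k → ℝ) ℂ, ⇑g = rsSlice (rsPhiTest Φ)) (w : Fin k → ℝ) :
    (∫ y : Fin k → ℝ, rsSlice (rsPhiTest Φ) y * Complex.exp (2 * π * I * ∑ i, (y i * w i : ℝ))) =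
      Φ (Fin.cons (-∑ i, w i) w) := by
  obtain ⟨g, hg⟩ := hslice
  -- the slice on Euclidean space
  set e : EuclideanSpace ℝ (Fin k) ≃L[ℝ] (Fin k → ℝ) :=
    PiLp.continuousLinearEquiv 2 ℝ (fun _ : Fin k ↦ ℝ) with he
  set ΦE : EuclideanSpace ℝ (Fin k) → ℂ :=
    fun v ↦ Φ (Fin.cons (-∑ i, (WithLp.ofLp v) i) (WithLp.ofLp v)) with hΦE
  have hΦEc : Continuous ΦE := (continuous_phiSlice hΦ).comp e.continuous
  have hΦEs : HasCompactSupport ΦE :=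
    (hasCompactSupport_phiSlice hΦ).comp_isClosedEmbedding e.toHomeomorph.isClosedEmbedding
  have hΦEi : Integrable ΦE := hΦEc.integrable_of_hasCompactSupport hΦEs
  -- its Fourier transform is the Schwartz slice
  set G : SchwartzMap (EuclideanSpace ℝ (Fin k)) ℂ :=
    SchwartzMap.compCLMOfContinuousLinearEquiv ℂ e g with hG
  have hGcoe : (⇑G : EuclideanSpace ℝ (Fin k) → ℂ) = fun v ↦ g (WithLp.ofLp v) := rfl
  have hFG : 𝓕 ΦE = ⇑G := by
    funext v
    have hv : v = WithLp.toLp 2 (WithLp.ofLp v) := rfl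
    rw [hv, hΦE, fourier_euclidean_toLp (fun η ↦ Φ (Fin.cons (-∑ i, η i) η)), hGcoe]
    beta_reduce
    rw [WithLp.ofLp_toLp, hg, rsSlice_rsPhiTest]
    congr 1
    funext η
    congr 2
    simp only [mul_comm]
  have hFGi : Integrable (𝓕 ΦE) := by
    rw [hFG]
    exact G.integrable
  -- inversion
  have hinv := hΦEc.fourierInv_fourier_eq hΦEi hFGi
  have hw : ΦE (WithLp.toLp 2 w) = Φ (Fin.cons (-∑ i, w i) w) := rfl
  rw [← hw, ← hinv, hFG, hGcoe, fourierInv_euclidean_toLp, hg]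

/-! ## One permutation -/

/-- `‖e^{2πi t}‖ = 1` for real `t`. [folklore] -/
theorem norm_cexp_two_pi_I_mul_real (t : ℝ) : ‖Complex.exp (2 * π * I * (t : ℂ))‖ = 1 := by
  rw [Complex.norm_exp]
  simp

/-- Fubini for the slice against a phase over the cube: the integrand
`(y, s) ↦ F(y) e(φ(y, s))` is integrable on `ℝᵏ × [-1/2,1/2]ⁿ`. [folklore] -/
theorem integrable_slice_mul_phase {k n : ℕ} (g : SchwartzMap (Fin k → ℝ) ℂ)
    (φ : (Fin k → ℝ) → (Fin n → ℝ) → ℝ) (hφ : Continuous (Function.uncurry φ)) :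
    Integrable (Function.uncurry fun (y : Fin k → ℝ) (s : Fin n → ℝ) ↦
      g y * Complex.exp (2 * π * I * (φ y s : ℝ))) (volume.prod (volume.restrict (rsCube n))) := by
  have hbound : Integrable (fun z : (Fin k → ℝ) × (Fin n → ℝ) ↦ ‖g z.1‖ * (1 : ℝ))
      (volume.prod (volume.restrict (rsCube n))) :=
    Integrable.mul_prod ((g.integrable (μ := volume)).norm) (integrable_const _)
  refine hbound.mono' ?_ (Filter.Eventually.of_forall fun ⟨y, s⟩ ↦ ?_)
  · refine Continuous.aestronglyMeasurable ?_
    exact (g.continuous.comp continuous_fst).mul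
      (Complex.continuous_exp.comp (continuous_const.mul (Complex.continuous_ofReal.comp hφ)))
  · rw [Function.uncurry_apply_pair, norm_mul, norm_cexp_two_pi_I_mul_real]

/-- **One permutation** (RS (4.27) with Lemma 4.2 kept on the cube): for admissible `Φ` with
Schwartz slice `F`, and `x = (0, y)`,
`∫ F(y) ∏_i K(x_{σ i} - x_i) dy = ∫_{[-1/2,1/2]ⁿ} Φ(s ∘ σ⁻¹ - s) ds`: write the product of
kernels as a cube integral, swap (Fubini), and invert the Fourier transform on the hyperplane
(`∑_i (x_{σ i} - x_i) s_i = x · (s ∘ σ⁻¹ - s)` and `∑_j (s ∘ σ⁻¹ - s)_j = 0`).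
[cite: RudnickSarnak1996, (4.27) and Lemma 4.2] -/
theorem integral_slice_mul_prod_sineKernel {k : ℕ} {Φ : (Fin (k + 1) → ℝ) → ℂ}
    (hΦ : IsRSAdmissiblePhi k Φ)
    (hslice : ∃ g : SchwartzMap (Fin k → ℝ) ℂ, ⇑g = rsSlice (rsPhiTest Φ))
    (σ : Perm (Fin (k + 1))) :
    (∫ y : Fin k → ℝ, rsSlice (rsPhiTest Φ) y *
        ∏ i, (sineKernel ((Fin.cons 0 y : Fin (k + 1) → ℝ) (σ i) - (Fin.cons 0 y : Fin (k + 1) → ℝ) i) : ℂ)) =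
      cubeFunctional σ⁻¹ Φ := by
  obtain ⟨g, hg⟩ := hslice
  -- the difference vector `w(s) = s ∘ σ⁻¹ - s` and the phase
  set w : (Fin (k + 1) → ℝ) → (Fin (k + 1) → ℝ) := fun s j ↦ s (σ⁻¹ j) - s j with hw
  set φ : (Fin k → ℝ) → (Fin (k + 1) → ℝ) → ℝ := fun y s ↦ ∑ i : Fin k, y i * w s i.succ with hφ
  -- Step 1: the product of kernels as a cube integral with phase `φ`
  have hprod : ∀ y : Fin k → ℝ,
      (∏ i, (sineKernel ((Fin.cons 0 y : Fin (k + 1) → ℝ) (σ i) -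
        (Fin.cons 0 y : Fin (k + 1) → ℝ) i) : ℂ)) =
        ∫ s in rsCube (k + 1), Complex.exp (2 * π * I * (φ y s : ℝ)) := by
    intro y
    rw [prod_sineKernel_eq_integral]
    refine setIntegral_congr_fun (measurableSet_rsCube _) fun s _ ↦ ?_
    congr 3
    -- `∑_i (x_{σ i} - x_i) s_i = ∑_j x_j (s_{σ⁻¹ j} - s_j) = ∑_{i<k} y_i w(s)_{i+1}`
    set x : Fin (k + 1) → ℝ := Fin.cons 0 y with hx
    have h1 : ∑ i, (x (σ i) - x i) * s i = ∑ j, x j * w s j := by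
      simp only [hw, sub_mul, mul_sub, Finset.sum_sub_distrib]
      congr 1
      exact (Equiv.sum_comp σ⁻¹ (fun i ↦ x (σ i) * s i)).symm.trans
        (Finset.sum_congr rfl fun j _ ↦ by simp)
    rw [h1, Fin.sum_univ_succ]
    simp [hx, hφ]
  -- Step 2: Fubini
  have hF : ∀ y, rsSlice (rsPhiTest Φ) y = g y := fun y ↦ by rw [hg]
  simp_rw [hprod, hF]
  have hswap : (∫ y : Fin k → ℝ, g y * ∫ s in rsCube (k + 1), Complex.exp (2 * π * I * (φ y s : ℝ))) =
      ∫ s in rsCube (k + 1), ∫ y : Fin k → ℝ, g y * Complex.exp (2 * π * I * (φ y s : ℝ)) := by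
    simp_rw [← integral_const_mul]
    have hφc : Continuous (Function.uncurry φ) := by
      simp only [hφ, hw]
      fun_prop
    exact integral_integral_swap (integrable_slice_mul_phase g φ hφc)
  rw [hswap, cubeFunctional]
  refine setIntegral_congr_fun (measurableSet_rsCube _) fun s _ ↦ ?_
  -- Step 3: Fourier inversion at `w' = (w(s)_1, …, w(s)_k)`
  have hinv := integral_slice_mul_cexp_eq hΦ ⟨g, hg⟩ (fun i ↦ w s i.succ)
  simp_rw [hF] at hinv
  simp only [hφ]
  rw [hinv]
  -- `(-∑ w', w') = w(s)` since `∑_j w(s)_j = 0`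
  congr 1
  funext j
  refine Fin.cases ?_ (fun i ↦ ?_) j
  · simp only [Fin.cons_zero]
    have hsum : ∑ j, w s j = 0 := by
      simp only [hw, Finset.sum_sub_distrib]
      rw [Equiv.sum_comp σ⁻¹ s, sub_self]
    rw [Fin.sum_univ_succ] at hsum
    linarith
  · simp only [Fin.cons_succ]
    rfl

/-! ## The theorem -/

/-- **The GUE functional as a signed sum of cube integrals** (RS, proof of Prop. 4.2, (4.27)
with `K = Ω̂` (4.21), paired with `Φ` via `f_Φ` (3.6)): for admissible `Φ` whose `f_Φ` has
Schwartz slice,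
`rsLimit k f_Φ = ∫ f_Φ(0, y) W_{k+1}(0, y) dy = ∑_{σ ∈ S_{k+1}} sign σ ∫_{[-1/2,1/2]^{k+1}} Φ(s ∘ σ - s) ds`.
Proof: determinant expansion, `integral_slice_mul_prod_sineKernel` for each `σ`, and the
reindexing `σ ↦ σ⁻¹`. [cite: RudnickSarnak1996, (4.27) and Lemma 4.2] -/
theorem rsLimit_rsPhiTest_eq_sum_cubeFunctional {k : ℕ} {Φ : (Fin (k + 1) → ℝ) → ℂ}
    (hΦ : IsRSAdmissiblePhi k Φ)
    (hslice : ∃ g : SchwartzMap (Fin k → ℝ) ℂ, ⇑g = rsSlice (rsPhiTest Φ)) :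
    rsLimit k (rsPhiTest Φ) =
      ∑ σ : Perm (Fin (k + 1)), ((Equiv.Perm.sign σ : ℤ) : ℂ) * cubeFunctional σ Φ := by
  obtain ⟨g, hg⟩ := hslice
  have hF : ∀ y, rsSlice (rsPhiTest Φ) y = g y := fun y ↦ by rw [hg]
  unfold rsLimit
  simp_rw [sineDeterminant_eq_sum, Finset.mul_sum]
  -- exchange sum and integral
  rw [integral_finsetSum]
  · -- termwise
    rw [← Equiv.sum_comp (Equiv.inv (Perm (Fin (k + 1))))]
    refine Finset.sum_congr rfl fun σ _ ↦ ?_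
    simp only [Equiv.inv_apply]
    have hσ := integral_slice_mul_prod_sineKernel hΦ ⟨g, hg⟩ σ⁻¹
    rw [inv_inv] at hσ
    rw [Equiv.Perm.sign_inv, ← hσ, ← integral_const_mul]
    refine integral_congr_ae (Filter.Eventually.of_forall fun y ↦ ?_)
    simp only
    ring
  · -- integrability of each term: Schwartz slice times a bounded continuous function
    intro σ _
    have hint : Integrable (fun y : Fin k → ℝ ↦
        (((Equiv.Perm.sign σ : ℤ) : ℂ) * ∏ i, (sineKernel ((Fin.cons 0 y : Fin (k + 1) → ℝ) (σ i) -
          (Fin.cons 0 y : Fin (k + 1) → ℝ) i) : ℂ)) * g y) := by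
      refine Integrable.bdd_mul (c := 1) (g.integrable (μ := volume)) ?_
        (Filter.Eventually.of_forall fun y ↦ ?_)
      · have hcons : Continuous fun y : Fin k → ℝ ↦ (Fin.cons (0 : ℝ) y : Fin (k + 1) → ℝ) := by
          refine continuous_pi fun j ↦ ?_
          refine Fin.cases ?_ (fun i ↦ ?_) j
          · simp only [Fin.cons_zero]
            exact continuous_const
          · simp only [Fin.cons_succ]
            exact continuous_apply i
        refine Continuous.aestronglyMeasurable ?_
        refine continuous_const.mul (continuous_finsetProd _ fun i _ ↦ ?_)
        refine Complex.continuous_ofReal.comp ?_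
        unfold sineKernel
        refine Real.continuous_sinc.comp (continuous_const.mul ?_)
        exact ((continuous_apply (σ i)).comp hcons).sub ((continuous_apply i).comp hcons)
      · rw [norm_mul]
        refine mul_le_one₀ ?_ (norm_nonneg _) (norm_prod_sineKernel_le _)
        rw [Complex.norm_intCast]
        rcases Int.units_eq_one_or (Equiv.Perm.sign σ) with h | h <;> simp [h]
    refine (hint.congr (Filter.Eventually.of_forall fun y ↦ ?_))
    simp only [hF]
    ring

end RudnickSarnak

end Literature.NumberTheory.LFunctions

end
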